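import Literature.RepresentationTheory.FiniteGroups.GL2ModularPrincipalSeries
import HarnessLib

/-!
# The Bruhat basis of the principal series `Ind_B^{GL₂(F)}(χ₁ ⊗ χ₂)` over a commutative coefficient ring

Topic `Literature/RepresentationTheory/FiniteGroups`, namespace `Literature.RepresentationTheory.FiniteGroups.GL2`
(continues `GL2ModularPrincipalSeries`, whose `principalSeriesRep F χ₁ χ₂ = Representation.coind …` is the function
model `{f : GL₂(F) → k | f(bx) = χ₁(b₀₀)χ₂(b₁₁)f(x)}` over ANY commutative coefficient ring `k`).  DEFINITIONS + API
(reviewed kind); no named fact, no instance, no notation, no `sorry`.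

D. Bump, *Automorphic Forms and Representations* [Bump1997], §4.1 Eq. (1.7): «`GL(2, F) = B(F) ∪ B(F) w₀ B(F)`
(disjoint) … a matrix `(a b; c d)` lies in `B(F)` if `c = 0`; otherwise `(a b; c d) = (1 a/c; 0 1) w₀ (c d; 0 D c⁻¹)`»;
hence (Bump, proof of Prop. 4.1.? / Exercise: «the dimension of `𝓑(χ₁, χ₂)` is `[GL(2,F) : B(F)] = q + 1`») a function
of the induced model is determined by, and can be prescribed arbitrarily through, its values on a set of
representatives of `B(F)\GL₂(F) = ℙ¹(F)`.  With the tree's right-translation convention and the explicit Bruhat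
factorisation `x = β(x)·w·u(x₁₁/x₁₀)` (`GL2.bruhat_eq`, `β = GL2.bruhatBorel`) the representatives are `1` and
`w u(t)`, `t ∈ F`.

## What is defined / proved (`F : Type` a field, `k` any commutative ring, `χ₁ χ₂ : Fˣ →* kˣ`)

* matrix lemmas for the Bruhat normal form: `(bx)₁₀ = b₁₁x₁₀`, `(bx)₁₁ = b₁₁x₁₁`, `b₁₁ ≠ 0`, the big cell is
  `B`-stable, **`bruhatBorel_borel_mul`** `β(bx) = b β(x)`, `borel_mul_ratio` (`x₁₁/x₁₀` is `B`-invariant),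
  `β(w u(t)) = 1`, `(w u(t))₁₀ = 1`, `(w u(t))₁₁ = t`;
* `bruhatEval χ₁ χ₂ : 𝓑(χ₁, χ₂) →ₗ[k] (Option F → k)`, `f ↦ (none ↦ f 1, some t ↦ f (w u(t)))`;
* `bruhatLiftFun` / `bruhatLift χ₁ χ₂ : (Option F → k) → 𝓑(χ₁, χ₂)` — the covariant function with prescribed
  values on the representatives (`bruhatLiftFun_mem`: it IS covariant, by `β(bx) = bβ(x)`);
* **`bruhatEquiv χ₁ χ₂ : 𝓑(χ₁, χ₂) ≃ₗ[k] (Option F → k)`** (`bruhatEval_bruhatLift`, `bruhatLift_bruhatEval`),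
  `ext_of_bruhatEval`; consequences `free_principalSeriesRep`, `finite_principalSeriesRep`,
  **`finrank_principalSeriesRep_eq`**: `rank_k 𝓑(χ₁, χ₂) = #F + 1` for every nontrivial commutative `k`
  (the tree had only `≤` over a field, `GL2ModularPrincipalSeriesLengthTwo.finrank_principalSeriesRep_le`, and `=`
  for `F = 𝔽_p` through the `Sym^r` embeddings).

Use (sequel `GL2ModularPrincipalSeriesReduction`): over `k = R` a `p`-adically integral ring this is the integral
structure `Fun_R(Ind(χ₁ ⊗ χ₂))`; the Bruhat coordinates give its freeness, the surjectivity of reduction mod `ϖ`, and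
`ker = ϖ · Fun_R` without any regularity hypothesis on `ϖ`.
-/

noncomputable section

namespace Literature.RepresentationTheory.FiniteGroups

namespace GL2

open Matrix

/-! ## Matrix lemmas for the Bruhat normal form -/
section BruhatMatrix

variable {F : Type} [Field F]

/-- `(b x)₁₀ = b₁₁ x₁₀` for `b ∈ B`. [cite: Bump1997, §4.1 Eq. (1.7)] -/
theorem borel_mul_apply_one_zero (b : borel F) (x : GL (Fin 2) F) :
    (((b : GL (Fin 2) F) * x : GL (Fin 2) F) : Matrix (Fin 2) (Fin 2) F) 1 0 =
      ((b : GL (Fin 2) F) : Matrix (Fin 2) (Fin 2) F) 1 1 * (x : Matrix (Fin 2) (Fin 2) F) 1 0 := by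
  have hb : ((b : GL (Fin 2) F) : Matrix (Fin 2) (Fin 2) F) 1 0 = 0 := (mem_borel_iff _).mp b.2
  rw [Matrix.GeneralLinearGroup.coe_mul, Matrix.mul_apply, Fin.sum_univ_two, hb, zero_mul, zero_add]

/-- `(b x)₁₁ = b₁₁ x₁₁` for `b ∈ B`. [cite: Bump1997, §4.1 Eq. (1.7)] -/
theorem borel_mul_apply_one_one (b : borel F) (x : GL (Fin 2) F) :
    (((b : GL (Fin 2) F) * x : GL (Fin 2) F) : Matrix (Fin 2) (Fin 2) F) 1 1 =
      ((b : GL (Fin 2) F) : Matrix (Fin 2) (Fin 2) F) 1 1 * (x : Matrix (Fin 2) (Fin 2) F) 1 1 := by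
  have hb : ((b : GL (Fin 2) F) : Matrix (Fin 2) (Fin 2) F) 1 0 = 0 := (mem_borel_iff _).mp b.2
  rw [Matrix.GeneralLinearGroup.coe_mul, Matrix.mul_apply, Fin.sum_univ_two, hb, zero_mul, zero_add]

/-- `b₁₁ ≠ 0` for `b ∈ B`. [cite: Bump1997, §4.1 Eq. (1.7)] -/
theorem borel_apply_one_one_ne_zero (b : borel F) :
    ((b : GL (Fin 2) F) : Matrix (Fin 2) (Fin 2) F) 1 1 ≠ 0 := by
  intro h
  have hdet := (b : GL (Fin 2) F).det_ne_zero
  rw [det_eq_of_mem_borel b.2, h, mul_zero] at hdet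
  exact hdet rfl

/-- The big cell is stable under left multiplication by `B`: `(b x)₁₀ ≠ 0 ↔ x₁₀ ≠ 0`. [cite: Bump1997, §4.1 Eq. (1.7)] -/
theorem borel_mul_apply_one_zero_ne_zero_iff (b : borel F) (x : GL (Fin 2) F) :
    (((b : GL (Fin 2) F) * x : GL (Fin 2) F) : Matrix (Fin 2) (Fin 2) F) 1 0 ≠ 0 ↔
      (x : Matrix (Fin 2) (Fin 2) F) 1 0 ≠ 0 := by
  rw [borel_mul_apply_one_zero, mul_ne_zero_iff]
  exact ⟨fun h => h.2, fun h => ⟨borel_apply_one_one_ne_zero b, h⟩⟩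

/-- **Equivariance of the Borel factor**: `β(b x) = b β(x)` on the big cell. [cite: Bump1997, §4.1 Eq. (1.7)] -/
theorem bruhatBorel_borel_mul (b : borel F) (x : GL (Fin 2) F)
    (hx : (x : Matrix (Fin 2) (Fin 2) F) 1 0 ≠ 0)
    (hbx : (((b : GL (Fin 2) F) * x : GL (Fin 2) F) : Matrix (Fin 2) (Fin 2) F) 1 0 ≠ 0) :
    bruhatBorel ((b : GL (Fin 2) F) * x) hbx = b * bruhatBorel x hx := by
  have hb : ((b : GL (Fin 2) F) : Matrix (Fin 2) (Fin 2) F) 1 0 = 0 := (mem_borel_iff _).mp b.2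
  have hb11 := borel_apply_one_one_ne_zero b
  refine Subtype.ext (Matrix.GeneralLinearGroup.ext fun i j => ?_)
  change ((bruhatBorel ((b : GL (Fin 2) F) * x) hbx : borel F) : GL (Fin 2) F) i j =
    (((b : GL (Fin 2) F) * (bruhatBorel x hx : GL (Fin 2) F) : GL (Fin 2) F) : Matrix (Fin 2) (Fin 2) F) i j
  rw [Matrix.GeneralLinearGroup.coe_mul]
  have e1 : ((bruhatBorel ((b : GL (Fin 2) F) * x) hbx : borel F) : GL (Fin 2) F) i j =
      (!![-(((b : GL (Fin 2) F) * x : GL (Fin 2) F) : Matrix (Fin 2) (Fin 2) F).det /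
            (((b : GL (Fin 2) F) * x : GL (Fin 2) F) : Matrix (Fin 2) (Fin 2) F) 1 0,
          (((b : GL (Fin 2) F) * x : GL (Fin 2) F) : Matrix (Fin 2) (Fin 2) F) 0 0;
          0, (((b : GL (Fin 2) F) * x : GL (Fin 2) F) : Matrix (Fin 2) (Fin 2) F) 1 0] :
        Matrix (Fin 2) (Fin 2) F) i j := by
    rw [← coe_bruhatBorel]
  rw [e1, coe_bruhatBorel, Matrix.GeneralLinearGroup.coe_mul, Matrix.det_mul]
  fin_cases i <;> fin_cases j <;>
    simp [Matrix.mul_apply, Fin.sum_univ_two, hb, Matrix.det_fin_two]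
  · field_simp
    ring

/-- The quotient `x₁₁/x₁₀` is `B`-invariant on the big cell. [cite: Bump1997, §4.1 Eq. (1.7)] -/
theorem borel_mul_ratio (b : borel F) (x : GL (Fin 2) F) :
    (((b : GL (Fin 2) F) * x : GL (Fin 2) F) : Matrix (Fin 2) (Fin 2) F) 1 1 /
        (((b : GL (Fin 2) F) * x : GL (Fin 2) F) : Matrix (Fin 2) (Fin 2) F) 1 0 =
      (x : Matrix (Fin 2) (Fin 2) F) 1 1 / (x : Matrix (Fin 2) (Fin 2) F) 1 0 := by
  rw [borel_mul_apply_one_one, borel_mul_apply_one_zero,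
    mul_div_mul_left _ _ (borel_apply_one_one_ne_zero b)]

/-- `(w u(t))₁₀ = 1`. [cite: Bump1997, §4.1 Eq. (1.7)] -/
theorem weyl_mul_upperUnip_apply_one_zero (t : F) :
    ((weyl F * upperUnip F t : GL (Fin 2) F) : Matrix (Fin 2) (Fin 2) F) 1 0 = 1 := by
  rw [Matrix.GeneralLinearGroup.coe_mul, coe_weyl, coe_upperUnip]
  simp [Matrix.mul_apply, Fin.sum_univ_two]

/-- `(w u(t))₁₁ = t`. [cite: Bump1997, §4.1 Eq. (1.7)] -/
theorem weyl_mul_upperUnip_apply_one_one (t : F) :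
    ((weyl F * upperUnip F t : GL (Fin 2) F) : Matrix (Fin 2) (Fin 2) F) 1 1 = t := by
  rw [Matrix.GeneralLinearGroup.coe_mul, coe_weyl, coe_upperUnip]
  simp [Matrix.mul_apply, Fin.sum_univ_two]

/-- `β(w u(t)) = 1`. [cite: Bump1997, §4.1 Eq. (1.7)] -/
theorem bruhatBorel_weyl_mul_upperUnip (t : F)
    (h : ((weyl F * upperUnip F t : GL (Fin 2) F) : Matrix (Fin 2) (Fin 2) F) 1 0 ≠ 0) :
    bruhatBorel (weyl F * upperUnip F t) h = 1 := by
  refine Subtype.ext (Matrix.GeneralLinearGroup.ext fun i j => ?_)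
  change ((bruhatBorel (weyl F * upperUnip F t) h : borel F) : GL (Fin 2) F) i j =
    ((1 : GL (Fin 2) F) : Matrix (Fin 2) (Fin 2) F) i j
  have e1 : ((bruhatBorel (weyl F * upperUnip F t) h : borel F) : GL (Fin 2) F) i j =
      (!![-((weyl F * upperUnip F t : GL (Fin 2) F) : Matrix (Fin 2) (Fin 2) F).det /
            ((weyl F * upperUnip F t : GL (Fin 2) F) : Matrix (Fin 2) (Fin 2) F) 1 0,
          ((weyl F * upperUnip F t : GL (Fin 2) F) : Matrix (Fin 2) (Fin 2) F) 0 0;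
          0, ((weyl F * upperUnip F t : GL (Fin 2) F) : Matrix (Fin 2) (Fin 2) F) 1 0] :
        Matrix (Fin 2) (Fin 2) F) i j := by
    rw [← coe_bruhatBorel]
  rw [e1, Matrix.GeneralLinearGroup.coe_mul, coe_weyl, coe_upperUnip, Matrix.det_mul]
  fin_cases i <;> fin_cases j <;> simp [Matrix.mul_apply, Fin.sum_univ_two, Matrix.det_fin_two_of]

/-- `1₁₀ = 0`. [cite: Bump1997, §4.1 Eq. (1.7)] -/
theorem one_apply_one_zero : ((1 : GL (Fin 2) F) : Matrix (Fin 2) (Fin 2) F) 1 0 = 0 := by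
  simp

end BruhatMatrix

/-! ## The evaluation isomorphism `𝓑(χ₁, χ₂) ≃ (Option F → k)` (Bruhat basis) -/
section Evaluation

variable {F : Type} [Field F] [DecidableEq F] {k : Type*} [CommRing k] (χ₁ χ₂ : Fˣ →* kˣ)

/-- **Evaluation at the Bruhat representatives**: `f ↦ (f(1), t ↦ f(w u(t)))`, a `k`-linear map
`𝓑(χ₁, χ₂) → (Option F → k)` (`none ↦ f 1`, `some t ↦ f (w u(t))`). [cite: Bump1997, §4.1 Eq. (1.7)] -/
def bruhatEval :
    Representation.coindV (borel F).subtype (scalarRep (borelCharacter F χ₁ χ₂)) →ₗ[k] (Option F → k) where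
  toFun f o := Option.elim o ((f : GL (Fin 2) F → k) 1) fun t => (f : GL (Fin 2) F → k) (weyl F * upperUnip F t)
  map_add' f g := by
    funext o; cases o <;> rfl
  map_smul' c f := by
    funext o; cases o <;> rfl

omit [DecidableEq F] in
/-- The `none`-coordinate is the value at `1`. [cite: Bump1997, §4.1 Eq. (1.7)] -/
@[simp]
theorem bruhatEval_none (f : Representation.coindV (borel F).subtype (scalarRep (borelCharacter F χ₁ χ₂))) :
    bruhatEval χ₁ χ₂ f none = (f : GL (Fin 2) F → k) 1 := rfl

omit [DecidableEq F] in
/-- The `some t`-coordinate is the value at `w u(t)`. [cite: Bump1997, §4.1 Eq. (1.7)] -/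
@[simp]
theorem bruhatEval_some (f : Representation.coindV (borel F).subtype (scalarRep (borelCharacter F χ₁ χ₂)))
    (t : F) : bruhatEval χ₁ χ₂ f (some t) = (f : GL (Fin 2) F → k) (weyl F * upperUnip F t) := rfl

/-- The function on `GL₂(F)` with prescribed values `φ` on the Bruhat representatives: on the small cell
`x ∈ B` it is `χ(x) φ(none)`, on the big cell `x = β(x) w u(x₁₁/x₁₀)` it is `χ(β(x)) φ(some (x₁₁/x₁₀))`. [cite: Bump1997, §4.1 Eq. (1.7)] -/
def bruhatLiftFun (φ : Option F → k) : GL (Fin 2) F → k := fun x =>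
  if hx : (x : Matrix (Fin 2) (Fin 2) F) 1 0 = 0 then
    (borelCharacter F χ₁ χ₂ ⟨x, (mem_borel_iff x).mpr hx⟩ : k) * φ none
  else
    (borelCharacter F χ₁ χ₂ (bruhatBorel x hx) : k) *
      φ (some ((x : Matrix (Fin 2) (Fin 2) F) 1 1 / (x : Matrix (Fin 2) (Fin 2) F) 1 0))

/-- The lifted function on the small cell `x₁₀ = 0`. [cite: Bump1997, §4.1 Eq. (1.7)] -/
theorem bruhatLiftFun_of_eq (φ : Option F → k) {x : GL (Fin 2) F} (hx : (x : Matrix (Fin 2) (Fin 2) F) 1 0 = 0) :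
    bruhatLiftFun χ₁ χ₂ φ x = (borelCharacter F χ₁ χ₂ ⟨x, (mem_borel_iff x).mpr hx⟩ : k) * φ none := by
  simp [bruhatLiftFun, hx]

/-- The lifted function on the big cell `x₁₀ ≠ 0`. [cite: Bump1997, §4.1 Eq. (1.7)] -/
theorem bruhatLiftFun_of_ne (φ : Option F → k) {x : GL (Fin 2) F} (hx : (x : Matrix (Fin 2) (Fin 2) F) 1 0 ≠ 0) :
    bruhatLiftFun χ₁ χ₂ φ x = (borelCharacter F χ₁ χ₂ (bruhatBorel x hx) : k) *
      φ (some ((x : Matrix (Fin 2) (Fin 2) F) 1 1 / (x : Matrix (Fin 2) (Fin 2) F) 1 0)) := by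
  simp [bruhatLiftFun, hx]

/-- The lifted function is `B`-covariant, i.e. lies in the principal series. [cite: Bump1997, §4.1 Eq. (1.7)] -/
theorem bruhatLiftFun_mem (φ : Option F → k) :
    bruhatLiftFun χ₁ χ₂ φ ∈ Representation.coindV (borel F).subtype (scalarRep (borelCharacter F χ₁ χ₂)) := by
  rw [mem_principalSeriesRep_iff]
  intro b x
  by_cases hx : (x : Matrix (Fin 2) (Fin 2) F) 1 0 = 0
  · -- small cell
    have hbx : (((b : GL (Fin 2) F) * x : GL (Fin 2) F) : Matrix (Fin 2) (Fin 2) F) 1 0 = 0 := by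
      rw [borel_mul_apply_one_zero, hx, mul_zero]
    rw [bruhatLiftFun_of_eq χ₁ χ₂ φ hbx, bruhatLiftFun_of_eq χ₁ χ₂ φ hx, ← mul_assoc, ← Units.val_mul,
      ← map_mul]
    rfl
  · -- big cell
    have hbx : (((b : GL (Fin 2) F) * x : GL (Fin 2) F) : Matrix (Fin 2) (Fin 2) F) 1 0 ≠ 0 :=
      (borel_mul_apply_one_zero_ne_zero_iff b x).mpr hx
    rw [bruhatLiftFun_of_ne χ₁ χ₂ φ hbx, bruhatLiftFun_of_ne χ₁ χ₂ φ hx, ← mul_assoc, ← Units.val_mul,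
      ← map_mul, bruhatBorel_borel_mul b x hx hbx, borel_mul_ratio]

/-- **The lift** `(Option F → k) → 𝓑(χ₁, χ₂)`. [cite: Bump1997, §4.1 Eq. (1.7)] -/
def bruhatLift (φ : Option F → k) :
    Representation.coindV (borel F).subtype (scalarRep (borelCharacter F χ₁ χ₂)) :=
  ⟨bruhatLiftFun χ₁ χ₂ φ, bruhatLiftFun_mem χ₁ χ₂ φ⟩

/-- Underlying function of the lift. [cite: Bump1997, §4.1 Eq. (1.7)] -/
@[simp]
theorem coe_bruhatLift (φ : Option F → k) :
    (bruhatLift χ₁ χ₂ φ : GL (Fin 2) F → k) = bruhatLiftFun χ₁ χ₂ φ := rfl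

/-- `eval ∘ lift = id`. [cite: Bump1997, §4.1 Eq. (1.7)] -/
theorem bruhatEval_bruhatLift (φ : Option F → k) : bruhatEval χ₁ χ₂ (bruhatLift χ₁ χ₂ φ) = φ := by
  funext o
  cases o with
  | none =>
    rw [bruhatEval_none, coe_bruhatLift, bruhatLiftFun_of_eq χ₁ χ₂ φ one_apply_one_zero]
    have : (⟨(1 : GL (Fin 2) F), (mem_borel_iff (1 : GL (Fin 2) F)).mpr one_apply_one_zero⟩ : borel F) = 1 :=
      rfl
    rw [this, map_one, Units.val_one, one_mul]
  | some t =>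
    have h := weyl_mul_upperUnip_apply_one_zero (F := F) t
    have hne : ((weyl F * upperUnip F t : GL (Fin 2) F) : Matrix (Fin 2) (Fin 2) F) 1 0 ≠ 0 := by
      rw [h]; exact one_ne_zero
    rw [bruhatEval_some, coe_bruhatLift, bruhatLiftFun_of_ne χ₁ χ₂ φ hne,
      bruhatBorel_weyl_mul_upperUnip t hne, map_one, Units.val_one, one_mul,
      weyl_mul_upperUnip_apply_one_one, h, div_one]

/-- A function of the principal series is determined by its values on the Bruhat representatives:
`lift ∘ eval = id`. [cite: Bump1997, §4.1 Eq. (1.7)] -/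
theorem bruhatLift_bruhatEval (f : Representation.coindV (borel F).subtype (scalarRep (borelCharacter F χ₁ χ₂))) :
    bruhatLift χ₁ χ₂ (bruhatEval χ₁ χ₂ f) = f := by
  refine Subtype.ext (funext fun x => ?_)
  rw [coe_bruhatLift]
  by_cases hx : (x : Matrix (Fin 2) (Fin 2) F) 1 0 = 0
  · rw [bruhatLiftFun_of_eq χ₁ χ₂ _ hx, bruhatEval_none]
    have := apply_borel_mul χ₁ χ₂ f ⟨x, (mem_borel_iff x).mpr hx⟩ 1
    rw [mul_one] at this
    exact this.symm
  · rw [bruhatLiftFun_of_ne χ₁ χ₂ _ hx, bruhatEval_some, ← apply_borel_mul χ₁ χ₂ f, ← mul_assoc,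
      ← bruhat_eq x hx]

/-- **The Bruhat basis isomorphism** `𝓑(χ₁, χ₂) ≃ₗ[k] (Option F → k)`: over ANY commutative coefficient
ring the principal series is free of rank `#ℙ¹(F) = #F + 1`, with coordinates the values at `1` and at
`w u(t)`, `t ∈ F`. [cite: Bump1997, §4.1 Eq. (1.7)] -/
def bruhatEquiv :
    Representation.coindV (borel F).subtype (scalarRep (borelCharacter F χ₁ χ₂)) ≃ₗ[k] (Option F → k) :=
  { bruhatEval χ₁ χ₂ with
    invFun := bruhatLift χ₁ χ₂
    left_inv := bruhatLift_bruhatEval χ₁ χ₂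
    right_inv := bruhatEval_bruhatLift χ₁ χ₂ }

/-- The Bruhat isomorphism is evaluation. [cite: Bump1997, §4.1 Eq. (1.7)] -/
@[simp]
theorem bruhatEquiv_apply (f : Representation.coindV (borel F).subtype (scalarRep (borelCharacter F χ₁ χ₂))) :
    bruhatEquiv χ₁ χ₂ f = bruhatEval χ₁ χ₂ f := rfl

/-- The inverse of the Bruhat isomorphism is the lift. [cite: Bump1997, §4.1 Eq. (1.7)] -/
@[simp]
theorem bruhatEquiv_symm_apply (φ : Option F → k) : (bruhatEquiv χ₁ χ₂).symm φ = bruhatLift χ₁ χ₂ φ := rfl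

/-- Two functions of the principal series with the same values at `1` and at every `w u(t)` are equal. [cite: Bump1997, §4.1 Eq. (1.7)] -/
theorem ext_of_bruhatEval {f g : Representation.coindV (borel F).subtype (scalarRep (borelCharacter F χ₁ χ₂))}
    (h1 : (f : GL (Fin 2) F → k) 1 = (g : GL (Fin 2) F → k) 1)
    (hw : ∀ t : F, (f : GL (Fin 2) F → k) (weyl F * upperUnip F t) = (g : GL (Fin 2) F → k) (weyl F * upperUnip F t)) :
    f = g := by
  apply (bruhatEquiv χ₁ χ₂).injective
  funext o
  cases o with
  | none => exact h1
  | some t => exact hw t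

/-- The principal series over a commutative ring is a free module. [cite: Bump1997, §4.1 Eq. (1.7)] -/
theorem free_principalSeriesRep [Finite F] :
    Module.Free k (Representation.coindV (borel F).subtype (scalarRep (borelCharacter F χ₁ χ₂))) :=
  Module.Free.of_equiv (bruhatEquiv χ₁ χ₂).symm

/-- The principal series over a commutative ring is finitely generated (`F` finite). [cite: Bump1997, §4.1 Eq. (1.7)] -/
theorem finite_principalSeriesRep [Finite F] :
    Module.Finite k (Representation.coindV (borel F).subtype (scalarRep (borelCharacter F χ₁ χ₂))) :=
  Module.Finite.equiv (bruhatEquiv χ₁ χ₂).symm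

/-- `rank 𝓑(χ₁, χ₂) = #F + 1` over any nontrivial commutative coefficient ring. [cite: Bump1997, §4.1 Eq. (1.7)] -/
theorem finrank_principalSeriesRep_eq [Fintype F] [Nontrivial k] :
    Module.finrank k (Representation.coindV (borel F).subtype (scalarRep (borelCharacter F χ₁ χ₂))) =
      Fintype.card F + 1 := by
  rw [(bruhatEquiv χ₁ χ₂).finrank_eq, Module.finrank_fintype_fun_eq_card, Fintype.card_option]

end Evaluation

end GL2

end Literature.RepresentationTheory.FiniteGroups
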